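import Summits.QuantumFields.YangMills.Theorems.BalabanLadderNTMarkovMirrorChiral
import Summits.QuantumFields.YangMills.Theorems.BalabanLadderNTMarkovMirrorPackage
import HarnessLib

/-!
# Crux `NT` (stmt-QuantumFields-19353) / `UVSeamRec.stub_floorsEngine` (stmt-QuantumFields-20043):
# the Markov–mirror floor WITHOUT the two-point shift ceiling

Sixth file of the Markov–mirror series (fleet lead prover of crux `UVSeamRec`, unit `ym-spine-20043-p1`, g6).
By the exact identity `Q2(θv, v) = Cov_T(Wᴿ∘Θ₀, Ṽ)` of `…MarkovMirrorChiral` (reflected-species smearing `Wᴿ`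
against the smearing `Ṽ` of the corner density), the card-E composition runs with the MIXED mirror form:
`Cov_T(Wᴿ∘Θ₀, Ṽ) = B(m_R, m)` (Markov mirror factorisation with `F₁ = Wᴿ ≠ F₂ = Ṽ`), `m_R = m + d + p'` with
`d := kerE_Q(Wᴿ)∘lift − kerE_Q(Ṽ)∘lift − p'` the boundary response of the CHIRALITY DEFECT, so
`Q2 = B(m, m) + B(d, m) ≥ X − √(B(d,d)·X)`, `X = Cov_T(Ṽ∘Θ₀, Ṽ) ≥ 9ε/4` (file `…Floor`), and a ONE-point
hypothesis `sup_ζ |kerE_Q^ζ(Wᴿ) − kerE_Q^ζ(Ṽ) − p'| ≤ √ε/2` (RBL-grade: the defect is a discrete time-derivative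
of `v` against electric plaquette fields, whose boundary response is `O(a)` under the plane-resolved boundary law
`FBL6` on the cube) replaces the two-point `ShiftCeiling` of `…Package`.  Result: `Q2(θv, v) ≥ ε`.

* §1 `window_of_two_le_depth`, regularity of `Wᴿ` (`continuous_reflSmear`, `exists_abs_reflSmear_le`,
  `exists_isCylinder_reflSmear`);
* §2 `chiral_floor_arith`; `Q2_ge_of_boundaryResponse_chiral` (one coupling, one torus);
* §3 `Q2_floor_of_mirrorPackage_chiral`, `lowerBounds_fst_of_mirrorPackage_chiral` (all large couplings / tori).

Refs: card `Cruxes/NT/Ideas/markov-mirror-dirichlet-response.md` (Mechanism; §ShiftCeiling); Osterwalder–Seiler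
1978 §2; Fröhlich–Israel–Lieb–Simon 1978 Thm 2.1.
-/

set_option autoImplicit false

noncomputable section

open scoped SchwartzMap
open MeasureTheory Filter Topology
open Literature.MathematicalPhysics.QuantumFieldTheory Literature.MathematicalPhysics.QuantumLattice
open Literature.Probability.LatticeModels
open Summit.QuantumFields.YangMills.Cruxes.OSLegsFromFemtoAndGap.DlrCollarTransfer
open Summit.QuantumFields.YangMills.Cruxes.OSLegsFromFemtoAndGap.DlrCollarTransfer.StubLower
  (mem_cubeSites_iff exists_abs_dens_le)
open Summit.QuantumFields.YangMills.Cruxes.NT.Reference (continuous_kerE continuous_kerE_torusLift eventually_le_of_tendsto)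
open Summit.QuantumFields.YangMills.Cruxes.NT.BoundaryLaw (abs_kerE_le)
open Summit.QuantumFields.YangMills.Cruxes.NT.Reflection (sq_cov_negReflect_le_odd_pos integrable_wilson_of_bdd)

namespace Summit.QuantumFields.YangMills.Cruxes.NT.MarkovMirror

/-! ## §1 Depth-two sites; regularity of the reflected-species smearing `Wᴿ` -/

section Regularity

/-- A site of depth `≥ 2` in the cube `(c, b)` satisfies `c + 1 ≤ y` and `y + 2 ≤ c + b` coordinatewise. [folklore] -/
theorem window_of_two_le_depth {c : Fin 4 → ℤ} {b : ℕ} {y : Fin 4 → ℤ} (hy : 2 ≤ depth c b y) (j : Fin 4) :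
    c j + 1 ≤ y j ∧ y j + 2 ≤ c j + b := by
  unfold depth at hy
  have h := (Finset.le_inf'_iff _ _).1 hy j (Finset.mem_univ j)
  rw [le_min_iff] at h
  obtain ⟨h1, h2⟩ := h
  have h1' : (2 : ℤ) ≤ y j - c j + 1 := by
    by_contra hc
    push Not at hc
    have : (y j - c j + 1).toNat ≤ 1 := by
      rcases le_or_gt 0 (y j - c j + 1) with h0 | h0
      · have := Int.toNat_of_nonneg h0; omega
      · rw [Int.toNat_eq_zero.2 h0.le]; omega
    omega
  have h2' : (2 : ℤ) ≤ c j + b - y j := by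
    by_contra hc
    push Not at hc
    have : (c j + b - y j).toNat ≤ 1 := by
      rcases le_or_gt 0 (c j + b - y j) with h0 | h0
      · have := Int.toNat_of_nonneg h0; omega
      · rw [Int.toNat_eq_zero.2 h0.le]; omega
    omega
  constructor <;> linarith

variable (G : Type) [Group G] [TopologicalSpace G] [IsTopologicalGroup G] [CompactSpace G]
  [MeasurableSpace G] [BorelSpace G] (r : LatticeRep G)

omit [Group G] [TopologicalSpace G] [IsTopologicalGroup G] [CompactSpace G] [MeasurableSpace G] [BorelSpace G] in
/-- A finite sum of cylinder observables is a cylinder observable on the union of the supports. [folklore] -/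
theorem isCylinder_finset_sum {ι : Type*} (s : Finset ι) (F : ι → LGConfig 4 G → ℝ)
    (S : ι → Finset (Literature.MathematicalPhysics.QuantumLattice.ZdEdge 4)) (hF : ∀ i ∈ s, IsCylinder (F i) (S i)) :
    IsCylinder (fun U => ∑ i ∈ s, F i U) (s.biUnion S) := by
  classical
  intro U V h
  refine Finset.sum_congr rfl fun i hi => ?_
  exact hF i hi fun e he => h e (Finset.mem_coe.2 (Finset.mem_biUnion.2 ⟨i, hi, Finset.mem_coe.1 he⟩))

omit [CompactSpace G] [BorelSpace G] in
/-- The reflected-species smearing `Wᴿ = ∑_x w x · ∑_q plane_q(x_q)` is continuous. [folklore] -/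
theorem continuous_reflSmear (S : Finset (Fin 4 → ℤ)) (w : (Fin 4 → ℤ) → ℝ) :
    Continuous fun V : LGConfig 4 G => ∑ x ∈ S, w x *
      ∑ q : {q : Fin 4 × Fin 4 // q.1 < q.2}, plane G r q.1 (if q.1.1 = 0 then x - Pi.single 0 1 else x) V :=
  continuous_finsetSum _ fun _ _ => continuous_const.mul
    (continuous_finsetSum _ fun _ _ => continuous_plane r _ _)

omit [Group G] [TopologicalSpace G] [IsTopologicalGroup G] [CompactSpace G] [MeasurableSpace G] [BorelSpace G] in
/-- A scalar multiple of a cylinder observable is a cylinder observable on the same links. [folklore] -/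
theorem isCylinder_const_mul {F : LGConfig 4 G → ℝ}
    {S : Finset (Literature.MathematicalPhysics.QuantumLattice.ZdEdge 4)} (hF : IsCylinder F S) (k : ℝ) :
    IsCylinder (fun U => k * F U) S := fun U V h => by
  show k * F U = k * F V
  rw [hF h]

omit [BorelSpace G] in
/-- The reflected-species smearing is bounded. [folklore] -/
theorem exists_abs_reflSmear_le (S : Finset (Fin 4 → ℤ)) (w : (Fin 4 → ℤ) → ℝ) :
    ∃ M : ℝ, ∀ V : LGConfig 4 G, |∑ x ∈ S, w x *
      ∑ q : {q : Fin 4 × Fin 4 // q.1 < q.2}, plane G r q.1 (if q.1.1 = 0 then x - Pi.single 0 1 else x) V| ≤ M := by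
  obtain ⟨C, hC⟩ := exists_abs_plane_le (G := G) r
  refine ⟨∑ x ∈ S, |w x| * ∑ q : {q : Fin 4 × Fin 4 // q.1 < q.2}, C, fun V => ?_⟩
  refine (Finset.abs_sum_le_sum_abs _ _).trans (Finset.sum_le_sum fun x _ => ?_)
  rw [abs_mul]
  refine mul_le_mul_of_nonneg_left ?_ (abs_nonneg _)
  exact (Finset.abs_sum_le_sum_abs _ _).trans (Finset.sum_le_sum fun q _ => hC _ _ _)

omit [IsTopologicalGroup G] [CompactSpace G] [BorelSpace G] in
/-- **The reflected-species smearing is carried by the cube** when the weights live at depth `≥ 2`: its links are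
based in the window `[c, c + b]` (the electric plaquettes one step down stay inside). [folklore] -/
theorem exists_isCylinder_reflSmear (c : Fin 4 → ℤ) (b : ℕ) (w : (Fin 4 → ℤ) → ℝ)
    (hw : ∀ x ∈ cubeSites c b, w x ≠ 0 → 2 ≤ depth c b x) :
    ∃ S : Finset (Literature.MathematicalPhysics.QuantumLattice.ZdEdge 4),
      IsCylinder (fun V : LGConfig 4 G => ∑ x ∈ cubeSites c b, w x *
        ∑ q : {q : Fin 4 × Fin 4 // q.1 < q.2}, plane G r q.1 (if q.1.1 = 0 then x - Pi.single 0 1 else x) V) S ∧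
      ∀ e ∈ S, ∀ j, c j ≤ e.1 j ∧ e.1 j ≤ c j + b := by
  classical
  -- drop the vanishing weights
  set S₀ := (cubeSites c b).filter fun x => w x ≠ 0 with hS₀
  have hfun : (fun V : LGConfig 4 G => ∑ x ∈ cubeSites c b, w x *
      ∑ q : {q : Fin 4 × Fin 4 // q.1 < q.2}, plane G r q.1 (if q.1.1 = 0 then x - Pi.single 0 1 else x) V) =
      fun V => ∑ x ∈ S₀, w x *
        ∑ q : {q : Fin 4 × Fin 4 // q.1 < q.2}, plane G r q.1 (if q.1.1 = 0 then x - Pi.single 0 1 else x) V := by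
    funext V
    rw [hS₀, Finset.sum_filter]
    refine Finset.sum_congr rfl fun x _ => ?_
    split_ifs with h
    · rfl
    · push Not at h; rw [h, zero_mul]
  have hinner : ∀ x : Fin 4 → ℤ, IsCylinder (fun V : LGConfig 4 G =>
      ∑ q : {q : Fin 4 × Fin 4 // q.1 < q.2}, plane G r q.1 (if q.1.1 = 0 then x - Pi.single 0 1 else x) V) _ :=
    fun x => isCylinder_finset_sum G Finset.univ _ _ fun q _ => isCylinder_plane r q.1 _
  have houter := isCylinder_finset_sum G S₀ _ _ fun x _ => isCylinder_const_mul G (hinner x) (w x)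
  rw [hfun]
  refine ⟨_, houter, fun e he j => ?_⟩
  obtain ⟨x, hx, hex⟩ := Finset.mem_biUnion.1 he
  obtain ⟨hxc, hwx⟩ := Finset.mem_filter.1 hx
  have hd := window_of_two_le_depth (hw x hxc hwx)
  obtain ⟨q, -, heq⟩ := Finset.mem_biUnion.1 hex
  have hn := near_of_mem_supp_plane heq j
  by_cases hq : q.1.1 = 0
  · simp only [hq, ↓reduceIte, Pi.sub_apply] at hn
    have h01 : (0 : ℤ) ≤ (Pi.single (0 : Fin 4) (1 : ℤ) : Fin 4 → ℤ) j ∧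
        (Pi.single (0 : Fin 4) (1 : ℤ) : Fin 4 → ℤ) j ≤ 1 := by
      by_cases hj : j = 0
      · subst hj; simp
      · simp [hj]
    constructor <;> linarith [hn.1, hn.2, (hd j).1, (hd j).2, h01.1, h01.2]
  · simp only [hq, ↓reduceIte] at hn
    constructor <;> linarith [hn.1, hn.2, (hd j).1, (hd j).2]

end Regularity

/-! ## §2 The chiral composition at one coupling on one torus -/

/-- **Scalar endgame of the chiral composition**: `X ≥ 9ε/4`, `bdm² ≤ bdd·X`, `bdd ≤ ε/4`, `ε > 0` give
`ε ≤ X + bdm` (`X + bdm ≥ X − (√ε/2)√X ≥ 3ε/2`). [folklore] -/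
theorem chiral_floor_arith {X bdm bdd ε : ℝ} (hX : 9 * ε / 4 ≤ X) (hcs : bdm ^ 2 ≤ bdd * X) (hd : bdd ≤ ε / 4)
    (hε : 0 < ε) : ε ≤ X + bdm := by
  have hX0 : 0 < X := by linarith
  set t := Real.sqrt X with ht
  have htt : t ^ 2 = X := Real.sq_sqrt hX0.le
  have hse : Real.sqrt ε ^ 2 = ε := Real.sq_sqrt hε.le
  have hs0 : 0 < Real.sqrt ε := Real.sqrt_pos.2 hε
  have ht0 : 0 ≤ t := Real.sqrt_nonneg _
  -- `t ≥ 3√ε/2`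
  have ht3 : 3 * Real.sqrt ε / 2 ≤ t := by
    rw [ht, show 3 * Real.sqrt ε / 2 = Real.sqrt (9 * ε / 4) by
      rw [show (9 : ℝ) * ε / 4 = (3 / 2) ^ 2 * ε by ring, Real.sqrt_mul (by positivity), Real.sqrt_sq (by norm_num)]
      ring]
    exact Real.sqrt_le_sqrt hX
  -- `|bdm| ≤ (√ε/2) t`
  have hb : |bdm| ≤ Real.sqrt ε / 2 * t := by
    have h1 : bdm ^ 2 ≤ (Real.sqrt ε / 2 * t) ^ 2 := by
      calc bdm ^ 2 ≤ bdd * X := hcs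
        _ ≤ ε / 4 * X := mul_le_mul_of_nonneg_right hd hX0.le
        _ = (Real.sqrt ε / 2 * t) ^ 2 := by rw [mul_pow, div_pow, hse, htt]; ring
    exact abs_le_of_sq_le_sq' h1 (by positivity) |>.2 |> fun h => abs_le.2 ⟨(abs_le_of_sq_le_sq' h1 (by positivity)).1, h⟩
  have hb' : -(Real.sqrt ε / 2 * t) ≤ bdm := (abs_le.1 hb).1
  nlinarith [htt, hse, ht3, hb', hs0]

section Floor

variable (G : Type) [Group G] [TopologicalSpace G] [IsTopologicalGroup G] [CompactSpace G]
  [MeasurableSpace G] [BorelSpace G] (r : LatticeRep G)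

/-- **The chiral mirror floor (card E at fixed `β ≥ 0` on the torus of side `2L+1`, no two-point ceiling).**
A cube `Q = (c, b)` at times `≥ 1` with its closed collar inside the window; a spacing `s` and a test function `v`
whose lattice support `{x : v(s·x) ≠ 0}` lies in `Q` at depth `≥ 2`; `Ṽ = ∑_y v(s·y) dens_y`,
`Wᴿ = ∑_x v(s·x) densᴿ_x` the reflected-species smearing; a shell functional `𝒢` on the closed collar, reference
values `p, p'`, `ε > 0`, with
(RBL+SUP) `|kerE_Q^ζ(Ṽ) − p + 𝒢 ζ| ≤ √ε/2`, (SF) `4ε ≤ Cov_T(𝒢∘Θ₀, 𝒢)`, and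
(RBLΔ) `|kerE_Q^ζ(Wᴿ) − kerE_Q^ζ(Ṽ) − p'| ≤ √ε/2` for every exterior `ζ`.
Then `ε ≤ Q2 G r β L s (θv) v`. [folklore] -/
theorem Q2_ge_of_boundaryResponse_chiral {β : ℝ} (hβ : 0 ≤ β) (c : Fin 4 → ℤ) (b L : ℕ) (hc0 : 1 ≤ c 0)
    (hcL : c 0 + (b : ℤ) + 3 ≤ L) (hc : ∀ j, -(L : ℤ) + 2 ≤ c j ∧ c j + (b : ℤ) + 2 ≤ (L : ℤ) + 1)
    (s : ℝ) (v : 𝓢(EuclideanSpace ℝ (Fin 4), ℝ))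
    (hsupp : ∀ x : Fin 4 → ℤ, v (s • siteToE x) ≠ 0 → x ∈ cubeSites c b ∧ 2 ≤ depth c b x)
    {𝒢 : LGConfig 4 G → ℝ} (h𝒢c : Continuous 𝒢) {M𝒢 : ℝ} (hM𝒢 : ∀ U, |𝒢 U| ≤ M𝒢)
    {S𝒢 : Finset (Literature.MathematicalPhysics.QuantumLattice.ZdEdge 4)} (h𝒢S : IsCylinder 𝒢 S𝒢)
    (hS𝒢 : ∀ e ∈ S𝒢, ∀ j, c j - 1 ≤ e.1 j ∧ e.1 j ≤ c j + b + 1)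
    {p p' ε : ℝ} (hε : 0 < ε)
    (hd : ∀ ζ, |kerE G r β c b ζ (fun V => ∑ y ∈ cubeSites c b, v (s • siteToE y) * dens G r y V) - p + 𝒢 ζ| ≤
      Real.sqrt ε / 2)
    (hSF : 4 * ε ≤ torusE G r β L (fun V => 𝒢 (cfgReflect V) * 𝒢 V) -
      torusE G r β L (fun V => 𝒢 (cfgReflect V)) * torusE G r β L 𝒢)
    (hΔ : ∀ ζ, |kerE G r β c b ζ (fun V => ∑ x ∈ cubeSites c b, v (s • siteToE x) *
        ∑ q : {q : Fin 4 × Fin 4 // q.1 < q.2}, plane G r q.1 (if q.1.1 = 0 then x - Pi.single 0 1 else x) V) -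
      kerE G r β c b ζ (fun V => ∑ y ∈ cubeSites c b, v (s • siteToE y) * dens G r y V) - p'| ≤ Real.sqrt ε / 2) :
    ε ≤ Q2 G r β L s (thetaTest 4 v) v := by
  classical
  haveI := r.secondCountableTopology
  haveI := isProbabilityMeasure_wilsonMeasure (d := 4) (L := 2 * L + 1) r.ρ r.continuous β
  -- the two cube-carried observables
  set W : LGConfig 4 G → ℝ := fun V => ∑ y ∈ cubeSites c b, v (s • siteToE y) * dens G r y V with hW
  set WR : LGConfig 4 G → ℝ := fun V => ∑ x ∈ cubeSites c b, v (s • siteToE x) *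
    ∑ q : {q : Fin 4 × Fin 4 // q.1 < q.2}, plane G r q.1 (if q.1.1 = 0 then x - Pi.single 0 1 else x) V with hWR
  have hWc : Continuous W := continuous_cubeSmear G r c b _
  obtain ⟨MW, hMW⟩ := exists_abs_cubeSmear_le G r c b (fun y => v (s • siteToE y))
  obtain ⟨SW, hWS, hSW⟩ := exists_isCylinder_cubeSmear G r c b (fun y => v (s • siteToE y))
  have hWRc : Continuous WR := continuous_reflSmear G r _ _
  obtain ⟨MR, hMR⟩ := exists_abs_reflSmear_le G r (cubeSites c b) (fun x => v (s • siteToE x))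
  obtain ⟨SR, hRS, hSR⟩ := exists_isCylinder_reflSmear G r c b (fun x => v (s • siteToE x))
    fun x _ hx => (hsupp x hx).2
  -- the cube sits in the box
  have hsub : cubeSites c b ⊆ box 4 L := fun y hy => by
    rw [mem_box]
    intro j
    have h := (mem_cubeSites_iff _ _ _).1 hy j
    have := hc j
    constructor <;> linarith [h.1, h.2]
  -- (0) `X := Cov_T(Ṽ∘Θ₀, Ṽ) ≥ 9ε/4`
  have hX := mirrorCov_ge_of_boundaryResponse G r hβ c b L hc0 hcL hc hWc hMW hWS hSW h𝒢c hM𝒢 h𝒢S hS𝒢 hε hd hSF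
  -- (1) `Q2 = Cov_T(Wᴿ∘Θ₀, Ṽ)`
  have hQ2 := Q2_thetaTest_eq_torusCov_reflSmear G r β L s v c b hsub fun x hx => (hsupp x hx).1
  -- (2) mirror factorisations
  have hfacR := torusCov_reflect_lift_eq_torusCov_reflect_kerE G r β c b L hc0 hcL hc hWRc hWc hMR hMW hRS hWS hSR hSW
  have hfacW := torusCov_reflect_lift_eq_torusCov_reflect_kerE G r β c b L hc0 hcL hc hWc hWc hMW hMW hWS hWS hSW hSW
  -- torus observables
  set m : GaugeConfig 4 (2 * L + 1) G → ℝ := fun U => kerE G r β c b (torusLift (2 * L + 1) U) W with hm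
  set mR : GaugeConfig 4 (2 * L + 1) G → ℝ := fun U => kerE G r β c b (torusLift (2 * L + 1) U) WR with hmR
  set D : GaugeConfig 4 (2 * L + 1) G → ℝ := fun U => mR U - m U - p' with hD
  have hmc : Continuous m := continuous_kerE_torusLift G r β c b (2 * L + 1) hWc hMW
  have hmb : ∀ U, |m U| ≤ MW := fun U => abs_kerE_le G r β c b _ hMW
  have hmRc : Continuous mR := continuous_kerE_torusLift G r β c b (2 * L + 1) hWRc hMR
  have hDc : Continuous D := (hmRc.sub hmc).sub continuous_const
  have hDb : ∀ U, |D U| ≤ Real.sqrt ε / 2 := fun U => hΔ _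
  -- non-negative-half dependence
  have hposm : DependsOn m {e : Edge 4 (2 * L + 1) | (e.1 0).val ≤ L ∧ ((e.1.shift e.2) 0).val ≤ L} :=
    dependsOn_posHalf_of_window L (isCylinder_kerE G r β c b hWc.measurable hWS) fun e he => by
      have := kerE_supp_window hSW he 0
      constructor <;> linarith [this.1, this.2]
  have hposR : DependsOn mR {e : Edge 4 (2 * L + 1) | (e.1 0).val ≤ L ∧ ((e.1.shift e.2) 0).val ≤ L} :=
    dependsOn_posHalf_of_window L (isCylinder_kerE G r β c b hWRc.measurable hRS) fun e he => by
      have := kerE_supp_window hSR he 0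
      constructor <;> linarith [this.1, this.2]
  have hposD : DependsOn D {e : Edge 4 (2 * L + 1) | (e.1 0).val ≤ L ∧ ((e.1.shift e.2) 0).val ≤ L} :=
    fun U V hUV => by simp only [hD, hposm hUV, hposR hUV]
  have hL1 : 1 ≤ L := by linarith
  -- (3) reflection-positivity Cauchy–Schwarz for `(D, m)` and the sup bound on `B(D, D)`
  have hcs := sq_cov_negReflect_le_odd_pos (d := 4) (L := 2 * L + 1) r.ρ rfl hL1 r.continuous hβ
    hDc.measurable hmc.measurable ⟨Real.sqrt ε / 2, hDb⟩ ⟨MW, hmb⟩ hposD hposm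
  have hdd := mirrorForm_le_sq (T := 2 * L + 1) r.ρ r.continuous β hDc.measurable hDb
  have hdd' : (∫ U, D U.negReflect * D U ∂(wilsonMeasure (d := 4) (L := 2 * L + 1) r.ρ β)) -
      (∫ U, D U ∂(wilsonMeasure (d := 4) (L := 2 * L + 1) r.ρ β)) ^ 2 ≤ ε / 4 := by
    rw [div_pow, Real.sq_sqrt hε.le] at hdd
    linarith
  -- integrability and invariance bookkeeping
  have hϑ : Measurable (GaugeConfig.negReflect : GaugeConfig 4 (2 * L + 1) G → GaugeConfig 4 (2 * L + 1) G) :=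
    WilsonSiteRP.measurable_negReflect
  have im : Integrable m (wilsonMeasure (d := 4) (L := 2 * L + 1) r.ρ β) :=
    integrable_wilson_of_bdd r.ρ r.continuous β hmc.measurable ⟨MW, hmb⟩
  have iD : Integrable D (wilsonMeasure (d := 4) (L := 2 * L + 1) r.ρ β) :=
    integrable_wilson_of_bdd r.ρ r.continuous β hDc.measurable ⟨Real.sqrt ε / 2, hDb⟩
  have imm : Integrable (fun U => m U.negReflect * m U) (wilsonMeasure (d := 4) (L := 2 * L + 1) r.ρ β) :=
    integrable_wilson_of_bdd r.ρ r.continuous β ((hmc.measurable.comp hϑ).mul hmc.measurable) ⟨MW * MW, fun U => by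
      rw [abs_mul]; exact mul_le_mul (hmb _) (hmb _) (abs_nonneg _) ((abs_nonneg _).trans (hmb U))⟩
  have iDm : Integrable (fun U => D U.negReflect * m U) (wilsonMeasure (d := 4) (L := 2 * L + 1) r.ρ β) :=
    integrable_wilson_of_bdd r.ρ r.continuous β ((hDc.measurable.comp hϑ).mul hmc.measurable)
      ⟨Real.sqrt ε / 2 * MW, fun U => by
        rw [abs_mul]
        exact mul_le_mul (hDb _) (hmb _) (abs_nonneg _) ((abs_nonneg _).trans (hDb (U.negReflect)))⟩
  have hinvR : ∫ U, mR U.negReflect ∂(wilsonMeasure (d := 4) (L := 2 * L + 1) r.ρ β) =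
      ∫ U, mR U ∂(wilsonMeasure (d := 4) (L := 2 * L + 1) r.ρ β) :=
    integral_comp_negReflect_eq (d := 4) (L := 2 * L + 1) r.ρ r.continuous β mR
  have hinvm : ∫ U, m U.negReflect ∂(wilsonMeasure (d := 4) (L := 2 * L + 1) r.ρ β) =
      ∫ U, m U ∂(wilsonMeasure (d := 4) (L := 2 * L + 1) r.ρ β) :=
    integral_comp_negReflect_eq (d := 4) (L := 2 * L + 1) r.ρ r.continuous β m
  -- (4) `B(m_R, m) = B(m, m) + B(D, m)`
  have emR : ∀ U, mR U = m U + D U + p' := fun U => by simp only [hD]; ring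
  have hsplit : (∫ U, mR U.negReflect * m U ∂(wilsonMeasure (d := 4) (L := 2 * L + 1) r.ρ β)) -
      (∫ U, mR U ∂(wilsonMeasure (d := 4) (L := 2 * L + 1) r.ρ β)) *
        (∫ U, m U ∂(wilsonMeasure (d := 4) (L := 2 * L + 1) r.ρ β)) =
      ((∫ U, m U.negReflect * m U ∂(wilsonMeasure (d := 4) (L := 2 * L + 1) r.ρ β)) -
        (∫ U, m U ∂(wilsonMeasure (d := 4) (L := 2 * L + 1) r.ρ β)) ^ 2) +
      ((∫ U, D U.negReflect * m U ∂(wilsonMeasure (d := 4) (L := 2 * L + 1) r.ρ β)) -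
        (∫ U, D U ∂(wilsonMeasure (d := 4) (L := 2 * L + 1) r.ρ β)) *
          (∫ U, m U ∂(wilsonMeasure (d := 4) (L := 2 * L + 1) r.ρ β))) := by
    have e1 : (fun U => mR U.negReflect * m U) =
        fun U => (m U.negReflect * m U + D U.negReflect * m U) + p' * m U := by
      funext U; rw [emR]; ring
    have e2 : (fun U => mR U) = fun U => (m U + D U) + p' := by funext U; rw [emR]
    have i1 : Integrable (fun U => m U.negReflect * m U + D U.negReflect * m U)
        (wilsonMeasure (d := 4) (L := 2 * L + 1) r.ρ β) := imm.add iDm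
    have i2 : Integrable (fun U => p' * m U) (wilsonMeasure (d := 4) (L := 2 * L + 1) r.ρ β) := im.const_mul p'
    have i3 : Integrable (fun U => m U + D U) (wilsonMeasure (d := 4) (L := 2 * L + 1) r.ρ β) := im.add iD
    rw [e1, integral_add i1 i2, integral_add imm iDm, integral_const_mul]
    rw [show (∫ U, mR U ∂(wilsonMeasure (d := 4) (L := 2 * L + 1) r.ρ β)) =
        ∫ U, (fun U => (m U + D U) + p') U ∂(wilsonMeasure (d := 4) (L := 2 * L + 1) r.ρ β) by rw [← e2],
      integral_add i3 (integrable_const _), integral_add im iD, integral_const, smul_eq_mul, probReal_univ]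
    ring
  -- assemble
  rw [hQ2, hfacR]
  unfold torusE at hfacW hX ⊢
  simp only [← torusLift_negReflect] at hfacW hX ⊢
  change ε ≤ (∫ U, mR U.negReflect * m U ∂(wilsonMeasure (d := 4) (L := 2 * L + 1) r.ρ β)) -
    (∫ U, mR U.negReflect ∂(wilsonMeasure (d := 4) (L := 2 * L + 1) r.ρ β)) *
      (∫ U, m U ∂(wilsonMeasure (d := 4) (L := 2 * L + 1) r.ρ β))
  rw [hinvR, hsplit]
  rw [hfacW] at hX
  change 9 * ε / 4 ≤ (∫ U, m U.negReflect * m U ∂(wilsonMeasure (d := 4) (L := 2 * L + 1) r.ρ β)) -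
    (∫ U, m U.negReflect ∂(wilsonMeasure (d := 4) (L := 2 * L + 1) r.ρ β)) *
      (∫ U, m U ∂(wilsonMeasure (d := 4) (L := 2 * L + 1) r.ρ β)) at hX
  rw [hinvm, ← sq] at hX
  exact chiral_floor_arith hX hcs hdd' hε

end Floor

end Summit.QuantumFields.YangMills.Cruxes.NT.MarkovMirror

end
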